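import Mathlib

/-!
# `SnSubsetDichotomy.HyperoctahedralThreshold` — stub `stub_badCount`

Bad fixed points come from short rich subwords (line `refutation-local-symmetry` of crux
`stmt-MatrixMultiplication-10883`, registered stub `stub_badCount` of the lead's skeleton).

Data: three fixed-point-free involutions `μ 0, μ 1, μ 2` of `Fin n`; a colour word
`z : List (Fin 3)` acts on the right, `x · z = z.foldl (fun v c => μ c v) x`; `z` is cyclically
reduced (`List.IsChain (· ≠ ·) (z ++ z)`) of length `ℓ ≥ 2`.  A fixed point `x` of `z` is *bad*
when its trajectory `t ↦ x · z.take t` (`t < ℓ`) is not injective.  Claim: if every nonempty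
cyclically reduced `τ` with `2 |τ| ≤ ℓ` has at most `M` distinct fixed points, then `z` has at
most `ℓ.choose 2 · M` distinct bad fixed points.

Proof.  Charge a bad fixed point `x` to a collision pair `s < t < ℓ` of its trajectory,
`x · z.take s = x · z.take t =: p`.  There are at most `ℓ.choose 2` pairs
(`BadCount.card_ltPairs_le`), so it suffices that over a fixed pair at most `M` points collide.
The collision point `p` (an injective function of `x`, `BadCount.foldl_injective`) is fixed both
by the factor `σ = z[s, t)` and by its cyclic complement `σ' = z.drop t ++ z.take s`
(`BadCount.fixed_of_collision`); both are nonempty reduced words (`BadCount.isChain_pieces`) and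
one of them, `τ₀`, has `2 |τ₀| ≤ ℓ`.  It remains to pass from the reduced word `τ₀` to a
cyclically reduced one (`BadCount.card_fixed_le`, induction on the length): a reduced word `w`
with distinct first and last letter is cyclically reduced; a single letter has no fixed point at
all; and if `w = a :: w' ++ [a]` then `μ a` carries the fixed points of `w` injectively onto fixed
points of the shorter reduced word `w' ≠ []`.
-/

namespace Summit.MatrixMultiplication.MatrixMultiplication.Theorems.HyperoctahedralThreshold

open Equiv

namespace BadCount

/-- The action of a word is injective (each letter acts by a permutation). [folklore] -/
theorem foldl_injective {α β : Type*} (μ : α → Perm β) (w : List α) :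
    Function.Injective fun v => w.foldl (fun v c => μ c v) v := by
  induction w with
  | nil =>
    intro a b h
    simpa using h
  | cons c w ih =>
    intro a b h
    simp only [List.foldl_cons] at h
    exact (μ c).injective (@ih (μ c a) (μ c b) h)

/-- **Cyclic reduction of fixed points.**  For fixed-point-free involutions `μ c`: if every
nonempty cyclically reduced word `τ` no longer than the nonempty reduced word `w` has at most `M`
distinct fixed points, then so does `w`.  Induction on the length: a single letter has no fixed
point; if the first and last letters of `w` differ then `w` itself is cyclically reduced; and if
`w = a :: w' ++ [a]` then `v ↦ μ a v` maps the fixed points of `w` injectively to fixed points of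
the shorter reduced word `w' ≠ []`. [folklore] -/
theorem card_fixed_le {α β : Type*} (μ : α → Perm β) (hμ : ∀ c v, μ c (μ c v) = v)
    (hfpf : ∀ c v, μ c v ≠ v) (M : ℕ) : ∀ (N : ℕ) (w : List α), w.length ≤ N → w ≠ [] →
    List.IsChain (· ≠ ·) w →
    (∀ τ : List α, τ ≠ [] → τ.length ≤ w.length → List.IsChain (· ≠ ·) (τ ++ τ) →
      ∀ (K : ℕ) (y : Fin K → β), Function.Injective y →
      (∀ i, τ.foldl (fun v c => μ c v) (y i) = y i) → K ≤ M) →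
    ∀ (K : ℕ) (y : Fin K → β), Function.Injective y →
    (∀ i, w.foldl (fun v c => μ c v) (y i) = y i) → K ≤ M := by
  intro N
  induction N with
  | zero =>
    intro w hw hne
    exact absurd (List.eq_nil_of_length_eq_zero (Nat.le_zero.1 hw)) hne
  | succ N ih =>
    intro w hw hne hc hM K y hy hfix
    rcases Nat.eq_zero_or_pos K with hK | hK
    · omega
    obtain ⟨a, w₁, rfl⟩ := List.exists_cons_of_ne_nil hne
    rcases List.eq_nil_or_concat' w₁ with rfl | ⟨w', b, rfl⟩
    · -- a single letter has no fixed point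
      have h := hfix ⟨0, hK⟩
      simp only [List.foldl_cons, List.foldl_nil] at h
      exact absurd h (hfpf a _)
    · by_cases hab : b = a
      · -- `w = a :: w' ++ [a]`: strip the two copies of `a` and recurse on `w'`
        subst b
        have hw' : w' ≠ [] := by
          rintro rfl
          simp at hc
        have hc' : List.IsChain (· ≠ ·) w' := hc.infix ⟨[a], [a], by simp⟩
        have hlen : w'.length ≤ N := by
          simp only [List.length_cons, List.length_append, List.length_nil] at hw
          omega
        have hM' : ∀ τ : List α, τ ≠ [] → τ.length ≤ w'.length → List.IsChain (· ≠ ·) (τ ++ τ) →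
            ∀ (K : ℕ) (y : Fin K → β), Function.Injective y →
            (∀ i, τ.foldl (fun v c => μ c v) (y i) = y i) → K ≤ M := fun τ hτ hτl =>
          hM τ hτ (by simp only [List.length_cons, List.length_append, List.length_nil]; omega)
        have hfix' : ∀ i, w'.foldl (fun v c => μ c v) (μ a (y i)) = μ a (y i) := by
          intro i
          have h := hfix i
          simp only [List.foldl_cons, List.foldl_append, List.foldl_nil] at h
          calc w'.foldl (fun v c => μ c v) (μ a (y i))
              = μ a (μ a (w'.foldl (fun v c => μ c v) (μ a (y i)))) := (hμ a _).symm
            _ = μ a (y i) := by rw [h]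
        exact ih w' hlen hw' hc' hM' K (fun i => μ a (y i)) (fun i j h => hy ((μ a).injective h))
          hfix'
      · -- first and last letters differ: `w` is cyclically reduced
        refine hM _ hne le_rfl (List.isChain_append.2 ⟨hc, hc, ?_⟩) K y hy hfix
        intro x hx x' hx'
        rw [← List.cons_append, List.getLast?_concat, Option.mem_def, Option.some.injEq] at hx
        rw [List.head?_cons, Option.mem_def, Option.some.injEq] at hx'
        rw [← hx, ← hx']
        exact hab

/-- A fixed point `v` of `z` whose trajectory collides at times `s ≤ t`
(`v · z.take s = v · z.take t`) yields a common fixed point `v · z.take s` of the factor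
`(z.drop s).take (t - s)` and of its cyclic complement `z.drop t ++ z.take s`. [folklore] -/
theorem fixed_of_collision {α β : Type*} (μ : α → Perm β) (z : List α) {s t : ℕ} (hst : s ≤ t)
    (v : β) (hfix : z.foldl (fun v c => μ c v) v = v)
    (hcol : (z.take s).foldl (fun v c => μ c v) v = (z.take t).foldl (fun v c => μ c v) v) :
    ((z.drop s).take (t - s)).foldl (fun v c => μ c v) ((z.take s).foldl (fun v c => μ c v) v) =
        (z.take s).foldl (fun v c => μ c v) v ∧
      (z.drop t ++ z.take s).foldl (fun v c => μ c v) ((z.take s).foldl (fun v c => μ c v) v) =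
        (z.take s).foldl (fun v c => μ c v) v := by
  constructor
  · rw [← List.foldl_append, ← List.take_add, Nat.add_sub_of_le hst]
    exact hcol.symm
  · have hv : (z.drop t).foldl (fun v c => μ c v) ((z.take t).foldl (fun v c => μ c v) v) = v := by
      rw [← List.foldl_append, List.take_append_drop]
      exact hfix
    rw [List.foldl_append, hcol, hv]
    exact hcol

/-- For a cyclically reduced word `z` and `t < |z|`, the factor `(z.drop s).take (t - s)` and the
cyclic complement `z.drop t ++ z.take s` are reduced. [folklore] -/
theorem isChain_pieces {α : Type*} {z : List α} (hz : List.IsChain (· ≠ ·) (z ++ z)) (s t : ℕ)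
    (ht : t < z.length) :
    List.IsChain (· ≠ ·) ((z.drop s).take (t - s)) ∧
      List.IsChain (· ≠ ·) (z.drop t ++ z.take s) := by
  obtain ⟨hc, -, hj⟩ := List.isChain_append.1 hz
  refine ⟨(hc.drop s).take (t - s), List.isChain_append.2 ⟨hc.drop t, hc.take s, ?_⟩⟩
  intro x hx y hy
  refine hj x ?_ y ?_
  · rw [List.getLast?_drop, if_neg (not_le.2 ht)] at hx
    exact hx
  · rw [List.head?_take] at hy
    by_cases hs : s = 0
    · rw [if_pos hs] at hy
      exact absurd hy (Option.not_mem_none y)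
    · rw [if_neg hs] at hy
      exact hy

/-- The pairs `s < t` in `Fin ℓ` number at most `ℓ.choose 2` (they inject into the off-diagonal
unordered pairs, counted by `Sym2.card_image_offDiag`). [folklore] -/
theorem card_ltPairs_le (ℓ : ℕ) :
    (Finset.univ.filter fun st : Fin ℓ × Fin ℓ => st.1 < st.2).card ≤ ℓ.choose 2 := by
  have h := Sym2.card_image_offDiag (Finset.univ : Finset (Fin ℓ))
  rw [Finset.card_univ, Fintype.card_fin] at h
  rw [← h]
  refine Finset.card_le_card_of_injOn (fun st => s(st.1, st.2)) ?_ ?_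
  · rintro ⟨a, b⟩ hab
    have hab' : a < b := (Finset.mem_filter.1 (Finset.mem_coe.1 hab)).2
    exact Finset.mem_coe.2 (Finset.mem_image.2
      ⟨(a, b), Finset.mem_offDiag.2 ⟨Finset.mem_univ _, Finset.mem_univ _, ne_of_lt hab'⟩, rfl⟩)
  · rintro ⟨a₁, a₂⟩ ha ⟨b₁, b₂⟩ hb hab
    have ha' : a₁ < a₂ := (Finset.mem_filter.1 (Finset.mem_coe.1 ha)).2
    have hb' : b₁ < b₂ := (Finset.mem_filter.1 (Finset.mem_coe.1 hb)).2
    dsimp only at hab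
    rcases Sym2.eq_iff.1 hab with ⟨h₁, h₂⟩ | ⟨h₁, h₂⟩
    · rw [h₁, h₂]
    · subst h₁ h₂
      exact absurd (ha'.trans hb') (lt_irrefl _)

end BadCount

open BadCount in
/-- **Stub `stub_badCount` — bad fixed points come from short rich subwords** (line
`refutation-local-symmetry` of crux `SnSubsetDichotomy.HyperoctahedralThreshold`,
stmt-MatrixMultiplication-10883).  For fixed-point-free involutions `μ 0, μ 1, μ 2` of `Fin n` and
a cyclically reduced word `z` of length `ℓ ≥ 2`: if every nonempty cyclically reduced `τ` with
`2 |τ| ≤ ℓ` has at most `M` distinct fixed points, then an injective family of bad fixed points of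
`z` (fixed points with a non-injective trajectory `t ↦ x · z.take t`, `t < ℓ`) has at most
`ℓ.choose 2 · M` members: charge each to a collision pair `s < t` (`BadCount.card_ltPairs_le`
pairs); over a fixed pair the collision points are distinct common fixed points of the factor
`z[s, t)` and of its cyclic complement (`BadCount.fixed_of_collision`), reduced words
(`BadCount.isChain_pieces`) one of which has length `≤ ℓ / 2`, whence at most `M` of them by
cyclic reduction (`BadCount.card_fixed_le`). [folklore] -/
theorem stub_badCount : ∀ (n : ℕ) (μ : Fin 3 → Equiv.Perm (Fin n)) (z : List (Fin 3)) (M m : ℕ) (x : Fin m → Fin n), (∀ c, μ c * μ c = 1) → (∀ c v, μ c v ≠ v) → 2 ≤ z.length → List.IsChain (· ≠ ·) (z ++ z) → (∀ τ : List (Fin 3), τ ≠ [] → 2 * τ.length ≤ z.length → List.IsChain (· ≠ ·) (τ ++ τ) → ∀ (m' : ℕ) (y : Fin m' → Fin n), Function.Injective y → (∀ i, τ.foldl (fun v c => μ c v) (y i) = y i) → m' ≤ M) → Function.Injective x → (∀ i, z.foldl (fun v c => μ c v) (x i) = x i) → (∀ i, ¬ Function.Injective (fun t : Fin z.length => (z.take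 (t : ℕ)).foldl (fun v c => μ c v) (x i))) → m ≤ z.length.choose 2 * M := by
  intro n μ z M m x hμ hfpf _hℓ hz hM hx hfix hbad
  -- the `μ c` are involutions, pointwise
  have hμ' : ∀ c v, μ c (μ c v) = v := fun c v => by
    rw [← Perm.mul_apply, hμ c, Perm.one_apply]
  -- charge every bad index to a collision pair `s < t` of its trajectory
  have hch : ∀ i : Fin m, ∃ st : Fin z.length × Fin z.length, st.1 < st.2 ∧
      (z.take (st.1 : ℕ)).foldl (fun v c => μ c v) (x i) =
        (z.take (st.2 : ℕ)).foldl (fun v c => μ c v) (x i) := by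
    intro i
    obtain ⟨s, t, hst, hne⟩ := Function.not_injective_iff.1 (hbad i)
    rcases lt_or_gt_of_ne hne with h | h
    · exact ⟨(s, t), h, hst⟩
    · exact ⟨(t, s), h, hst.symm⟩
  choose ch hch₁ hch₂ using hch
  -- count: `m ≤ M · #{pairs}`, provided each pair is charged at most `M` times
  have h1 : (Finset.univ : Finset (Fin m)).card ≤
      M * (Finset.univ.filter fun st : Fin z.length × Fin z.length => st.1 < st.2).card := by
    refine Finset.card_le_mul_card_image_of_maps_to
      (fun i _ => Finset.mem_filter.2 ⟨Finset.mem_univ _, hch₁ i⟩) M ?_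
    rintro ⟨s, t⟩ hst
    simp only [Finset.mem_filter, Finset.mem_univ, true_and] at hst
    suffices hF : ∀ F : Finset (Fin m), (∀ i ∈ F, ch i = (s, t)) → F.card ≤ M from
      hF _ fun i hi => (Finset.mem_filter.1 hi).2
    intro F hFm
    have hs : (s : ℕ) < t := hst
    have ht : (t : ℕ) < z.length := t.2
    -- members of `F` collide at `(s, t)`
    have hmem : ∀ i ∈ F, (z.take (s : ℕ)).foldl (fun v c => μ c v) (x i) =
        (z.take (t : ℕ)).foldl (fun v c => μ c v) (x i) := by
      intro i hi
      have h := hch₂ i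
      rw [hFm i hi] at h
      exact h
    -- the injective family of collision points
    obtain ⟨y, hy⟩ : ∃ y : Fin F.card → Fin n,
        ∀ j, y j = (z.take (s : ℕ)).foldl (fun v c => μ c v) (x (F.equivFin.symm j)) :=
      ⟨_, fun j => rfl⟩
    have hyinj : Function.Injective y := by
      intro j j' h
      rw [hy, hy] at h
      exact F.equivFin.symm.injective (Subtype.ext (hx (foldl_injective μ _ h)))
    -- they are common fixed points of the factor `z[s, t)` and of its cyclic complement
    have hyfix : ∀ j,
        ((z.drop (s : ℕ)).take ((t : ℕ) - s)).foldl (fun v c => μ c v) (y j) = y j ∧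
          (z.drop (t : ℕ) ++ z.take (s : ℕ)).foldl (fun v c => μ c v) (y j) = y j := fun j => by
      rw [hy]
      exact fixed_of_collision μ z hs.le _ (hfix _) (hmem _ (F.equivFin.symm j).2)
    obtain ⟨hc₁, hc₂⟩ := isChain_pieces hz s t ht
    have hlen₁ : ((z.drop (s : ℕ)).take ((t : ℕ) - s)).length = t - s := by
      simp only [List.length_take, List.length_drop]
      omega
    have hlen₂ : (z.drop (t : ℕ) ++ z.take (s : ℕ)).length = z.length - t + s := by
      simp only [List.length_append, List.length_drop, List.length_take]
      omega
    -- the shorter of the two words has length `≤ ℓ / 2`; reduce it cyclically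
    by_cases h2 : 2 * ((t : ℕ) - s) ≤ z.length
    · exact card_fixed_le μ hμ' hfpf M _ ((z.drop (s : ℕ)).take ((t : ℕ) - s)) le_rfl
        (List.ne_nil_of_length_pos (by omega)) hc₁
        (fun τ hτ hτl hτc K y' hy' hfy' => hM τ hτ (by omega) hτc K y' hy' hfy') _ y hyinj
        fun j => (hyfix j).1
    · exact card_fixed_le μ hμ' hfpf M _ (z.drop (t : ℕ) ++ z.take (s : ℕ)) le_rfl
        (List.ne_nil_of_length_pos (by omega)) hc₂
        (fun τ hτ hτl hτc K y' hy' hfy' => hM τ hτ (by omega) hτc K y' hy' hfy') _ y hyinj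
        fun j => (hyfix j).2
  rw [Finset.card_univ, Fintype.card_fin] at h1
  calc m ≤ _ := h1
    _ ≤ M * z.length.choose 2 := Nat.mul_le_mul_left M (card_ltPairs_le z.length)
    _ = z.length.choose 2 * M := Nat.mul_comm _ _

end Summit.MatrixMultiplication.MatrixMultiplication.Theorems.HyperoctahedralThreshold
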